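import Literature.NumberTheory.Transcendental.PadicExpBallProofs
import HarnessLib

/-!
# Cell abc-stewartyu, WP-A2 support (a): the `ℓ`-adic exponential on the CLOSED ball `‖a‖ ≤ ℓ⁻¹`
# for an odd prime `ℓ`

`Summits/ABC/StewartYu/PadicExpOddPrime.lean` — cell `abc-stewartyu` (HOME
`run/shared/lean/pub/abc-stewartyu/`, seat p3; support for work package WP-A2 of
`HOME/p2/PADIC-CORE.md` §3 ("CARE: Brumer needs `‖ℓ‖ < p⁻¹`, i.e. `αⱼ ≡ 1 (p²)`. We have only
`αⱼ ≡ 1 (p)`"); theorems only, no definition, no named fact).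

The tree's `PadicExpBallProofs.lean` develops Mathlib's `NormedSpace.exp` on the OPEN ball
`‖a‖ < ℓ⁻¹` of a complete ultrametric normed `ℚ_ℓ`-algebra field.  The principal-unit generators of
the `p`-adic Baker argument are only `≡ 1 (mod ℓ)`, i.e. their logarithms have norm EXACTLY `ℓ⁻¹` in
general, so the closed ball is needed; for an ODD prime `ℓ` it lies strictly inside the disc of
convergence `‖a‖ < ℓ^{-1/(ℓ-1)}` (Yu 1989, §1.1: for `p ≥ 3` no `p`-power raising is necessary,
`κ = 0`).  With Legendre's bound in the form `v_ℓ(n!) ≤ ⌊(n−1)/2⌋` (`ℓ ≥ 3`):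

* `inv_sqrt_le_expSeries_radius` — `ℓ^{-1/2} ≤` radius of convergence, so the closed ball
  `‖a‖ ≤ ℓ⁻¹` lies in the disc of convergence (`mem_eball_of_norm_le`);
* `exp_add_of_le`, `hasSum_exp_of_le`, `exp_natCast_mul_of_le`, `exp_intCast_mul_of_le`;
* `norm_exp_sub_one_sub_self_le_sq` — `‖exp a − 1 − a‖ ≤ ‖a‖²`; `norm_exp_sub_one_of_le` —
  `‖exp a − 1‖ = ‖a‖`; `norm_exp_of_le`, `exp_eq_one_iff_of_le`, `exp_neg_of_le`, `exp_injOn_closedBall`.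

The sequel `PadicExpLogOddPrime.lean` proves that `exp` and the tree's Iwasawa logarithm are
mutually inverse between `ℓℤ_ℓ` and `1 + ℓℤ_ℓ` inside `ℚ_ℓ`.
Everything is [folklore] (Koblitz GTM 58 Ch. IV §1; Robert GTM 198 Ch. 5 §4).
-/

noncomputable section

open NormedSpace Filter Topology Metric
open scoped ENNReal NNReal Nat

namespace Summit.ABC.StewartYu

namespace PadicExpOdd

open Literature.NumberTheory.Transcendental

variable {ℓ : ℕ} [Fact ℓ.Prime]

/-! ### Legendre for `ℓ ≥ 3`: `v_ℓ(n!) ≤ ⌊(n−1)/2⌋` -/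

/-- `v_ℓ(n!) ≤ ⌊(n − 1)/2⌋` for a prime `ℓ ≠ 2` (`(ℓ−1) v_ℓ(n!) ≤ n − 1` and `ℓ − 1 ≥ 2`). [folklore] -/
theorem padicValNat_factorial_le_div_two (hℓ : ℓ ≠ 2) (n : ℕ) : padicValNat ℓ n ! ≤ (n - 1) / 2 := by
  have hp : ℓ.Prime := Fact.out
  have h3 : 3 ≤ ℓ := by
    rcases hp.eq_two_or_odd with h | h
    · exact absurd h hℓ
    · have := hp.two_le; omega
  rcases Nat.eq_zero_or_pos n with rfl | hn
  · simp
  · have h := sub_one_mul_padicValNat_factorial_lt_of_ne_zero ℓ hn.ne'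
    have h2 : 2 * padicValNat ℓ n ! ≤ (ℓ - 1) * padicValNat ℓ n ! := Nat.mul_le_mul_right _ (by omega)
    rw [Nat.le_div_iff_mul_le two_pos]
    omega

/-- `‖(n!)⁻¹‖_ℓ ≤ ℓ^{⌊(n−1)/2⌋}` for `ℓ ≠ 2`. [folklore] -/
theorem norm_inv_natCast_factorial_padic_le (hℓ : ℓ ≠ 2) (n : ℕ) :
    ‖((n ! : ℕ) : ℚ_[ℓ])⁻¹‖ ≤ (ℓ : ℝ) ^ ((n - 1) / 2) := by
  have hp : ℓ.Prime := Fact.out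
  have hne : ((n ! : ℕ) : ℚ_[ℓ]) ≠ 0 := by exact_mod_cast n.factorial_ne_zero
  rw [norm_inv, Padic.norm_eq_zpow_neg_valuation hne, Padic.valuation_natCast, zpow_neg, inv_inv,
    zpow_natCast]
  exact pow_le_pow_right₀ (by exact_mod_cast hp.one_lt.le) (padicValNat_factorial_le_div_two hℓ n)

variable {E : Type*} [NontriviallyNormedField E] [NormedAlgebra ℚ_[ℓ] E]

/-- `‖(n!)⁻¹‖_E ≤ ℓ^{⌊(n−1)/2⌋}` for `ℓ ≠ 2`. [folklore] -/
theorem norm_inv_natCast_factorial_le (hℓ : ℓ ≠ 2) (n : ℕ) :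
    ‖((n ! : ℕ) : E)⁻¹‖ ≤ (ℓ : ℝ) ^ ((n - 1) / 2) := by
  rw [norm_inv, PadicExp.norm_natCast (ℓ := ℓ), ← norm_inv]
  exact norm_inv_natCast_factorial_padic_le hℓ n

/-- The general term: `‖aⁿ / n!‖ ≤ ‖a‖ⁿ ℓ^{⌊(n−1)/2⌋}` (`ℓ ≠ 2`). [folklore] -/
theorem norm_pow_div_factorial_le (hℓ : ℓ ≠ 2) (a : E) (n : ℕ) :
    ‖a ^ n / (n ! : E)‖ ≤ ‖a‖ ^ n * (ℓ : ℝ) ^ ((n - 1) / 2) := by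
  rw [div_eq_mul_inv, norm_mul, norm_pow]
  refine mul_le_mul_of_nonneg_left ?_ (pow_nonneg (norm_nonneg _) _)
  exact_mod_cast norm_inv_natCast_factorial_le (ℓ := ℓ) (E := E) hℓ n

/-- On the closed ball `‖a‖ ≤ ℓ⁻¹` (`ℓ ≠ 2`): `‖aⁿ / n!‖ ≤ ‖a‖²` for `n ≥ 2`
(`‖a‖^{n−2} ℓ^{⌊(n−1)/2⌋} ≤ ℓ^{⌊(n−1)/2⌋ − (n−2)} ≤ 1`). [folklore] -/
theorem norm_pow_div_factorial_le_sq (hℓ : ℓ ≠ 2) {a : E} (ha : ‖a‖ ≤ (ℓ : ℝ)⁻¹) {n : ℕ} (hn : 2 ≤ n) :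
    ‖a ^ n / (n ! : E)‖ ≤ ‖a‖ ^ 2 := by
  have hp : ℓ.Prime := Fact.out
  have hℓ0 : (0 : ℝ) < ℓ := by exact_mod_cast hp.pos
  have hℓ1 : (1 : ℝ) ≤ ℓ := by exact_mod_cast hp.one_lt.le
  refine (norm_pow_div_factorial_le hℓ a n).trans ?_
  obtain ⟨k, rfl⟩ : ∃ k, n = k + 2 := ⟨n - 2, by omega⟩
  rw [pow_add, mul_comm (‖a‖ ^ k), mul_assoc]
  refine mul_le_of_le_one_right (pow_nonneg (norm_nonneg _) _) ?_
  -- `‖a‖^k ℓ^{⌊(k+1)/2⌋} ≤ ℓ^{-k} ℓ^{⌊(k+1)/2⌋} ≤ 1`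
  have h1 : ‖a‖ ^ k ≤ ((ℓ : ℝ)⁻¹) ^ k := pow_le_pow_left₀ (norm_nonneg _) ha k
  have h2 : (ℓ : ℝ) ^ ((k + 2 - 1) / 2) ≤ (ℓ : ℝ) ^ k := pow_le_pow_right₀ hℓ1 (by omega)
  calc ‖a‖ ^ k * (ℓ : ℝ) ^ ((k + 2 - 1) / 2) ≤ ((ℓ : ℝ)⁻¹) ^ k * (ℓ : ℝ) ^ k :=
        mul_le_mul h1 h2 (by positivity) (by positivity)
    _ = 1 := by rw [inv_pow, inv_mul_cancel₀ (by positivity)]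

/-! ### The radius of convergence -/

/-- **`ℓ^{-1/2} ≤` radius of convergence of the exponential series** over `ℚ_ℓ` for `ℓ ≠ 2`
(`‖expSeries n‖ ℓ^{-n/2} ≤ ℓ^{⌊(n−1)/2⌋ − n/2} ≤ 1`). [folklore] -/
theorem inv_sqrt_le_expSeries_radius (hℓ : ℓ ≠ 2) :
    (((NNReal.sqrt ℓ)⁻¹ : ℝ≥0) : ℝ≥0∞) ≤ (expSeries ℚ_[ℓ] E).radius := by
  have hp : ℓ.Prime := Fact.out
  have hℓ0 : (0 : ℝ) < ℓ := by exact_mod_cast hp.pos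
  have hs0 : 0 < Real.sqrt ℓ := Real.sqrt_pos.mpr hℓ0
  have hs1 : 1 ≤ Real.sqrt ℓ := by
    rw [show (1 : ℝ) = Real.sqrt 1 by simp]
    exact Real.sqrt_le_sqrt (by exact_mod_cast hp.one_lt.le)
  refine FormalMultilinearSeries.le_radius_of_bound _ 1 fun n => ?_
  have h1 : ‖expSeries ℚ_[ℓ] E n‖ ≤ (ℓ : ℝ) ^ ((n - 1) / 2) := by
    rw [expSeries, norm_smul, ContinuousMultilinearMap.norm_mkPiAlgebraFin, mul_one]
    have : ((n !⁻¹ : ℚ_[ℓ])) = ((n ! : ℕ) : ℚ_[ℓ])⁻¹ := by norm_cast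
    rw [this]
    exact norm_inv_natCast_factorial_padic_le hℓ n
  have h2 : (((NNReal.sqrt ℓ)⁻¹ : ℝ≥0) : ℝ) ^ n = (Real.sqrt ℓ ^ n)⁻¹ := by
    rw [NNReal.coe_inv, Real.coe_sqrt, NNReal.coe_natCast, inv_pow]
  rw [h2]
  -- `ℓ^{⌊(n-1)/2⌋} ≤ (√ℓ)^{2 ⌊(n-1)/2⌋} ≤ (√ℓ)^n`
  have h3 : (ℓ : ℝ) ^ ((n - 1) / 2) ≤ Real.sqrt ℓ ^ n := by
    have e : (ℓ : ℝ) ^ ((n - 1) / 2) = Real.sqrt ℓ ^ (2 * ((n - 1) / 2)) := by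
      rw [pow_mul, Real.sq_sqrt hℓ0.le]
    rw [e]
    exact pow_le_pow_right₀ hs1 (by omega)
  calc ‖expSeries ℚ_[ℓ] E n‖ * (Real.sqrt ℓ ^ n)⁻¹ ≤ Real.sqrt ℓ ^ n * (Real.sqrt ℓ ^ n)⁻¹ :=
        mul_le_mul_of_nonneg_right (h1.trans h3) (by positivity)
    _ = 1 := mul_inv_cancel₀ (by positivity)

/-- Points of the CLOSED ball `‖a‖ ≤ ℓ⁻¹` lie in the disc of convergence (`ℓ ≠ 2`: `ℓ⁻¹ < ℓ^{-1/2}`).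
[folklore] -/
theorem mem_eball_of_norm_le (hℓ : ℓ ≠ 2) {a : E} (ha : ‖a‖ ≤ (ℓ : ℝ)⁻¹) :
    a ∈ eball (0 : E) (expSeries ℚ_[ℓ] E).radius := by
  have hp : ℓ.Prime := Fact.out
  have hℓ0 : (0 : ℝ) < ℓ := by exact_mod_cast hp.pos
  have hℓ1 : (1 : ℝ) < ℓ := by exact_mod_cast hp.one_lt
  rw [mem_eball_zero_iff]
  refine lt_of_lt_of_le ?_ (inv_sqrt_le_expSeries_radius hℓ)
  rw [enorm_eq_nnnorm, ENNReal.coe_lt_coe, ← NNReal.coe_lt_coe, coe_nnnorm, NNReal.coe_inv,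
    Real.coe_sqrt, NNReal.coe_natCast]
  refine lt_of_le_of_lt ha ?_
  -- `ℓ⁻¹ < (√ℓ)⁻¹` since `√ℓ < ℓ`
  have hlt : Real.sqrt ℓ < ℓ := by
    rw [Real.sqrt_lt' hℓ0]; nlinarith
  exact (inv_lt_inv₀ hℓ0 (Real.sqrt_pos.mpr hℓ0)).mpr hlt

/-! ### The functional equation and the series on the closed ball -/

section Complete

variable [CompleteSpace E]

/-- **`exp (a + b) = exp a · exp b`** on the closed ball `‖·‖ ≤ ℓ⁻¹` (`ℓ ≠ 2`). [folklore] -/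
theorem exp_add_of_le (hℓ : ℓ ≠ 2) {a b : E} (ha : ‖a‖ ≤ (ℓ : ℝ)⁻¹) (hb : ‖b‖ ≤ (ℓ : ℝ)⁻¹) :
    exp (a + b) = exp a * exp b :=
  exp_add_of_mem_ball (mem_eball_of_norm_le hℓ ha) (mem_eball_of_norm_le hℓ hb)

/-- The exponential series `exp a = ∑ aⁿ / n!` on the closed ball (`ℓ ≠ 2`). [folklore] -/
theorem hasSum_exp_of_le (hℓ : ℓ ≠ 2) {a : E} (ha : ‖a‖ ≤ (ℓ : ℝ)⁻¹) :
    HasSum (fun n : ℕ => a ^ n / (n ! : E)) (exp a) := by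
  have h := expSeries_hasSum_exp_of_mem_ball' (𝕂 := ℚ_[ℓ]) a (mem_eball_of_norm_le hℓ ha)
  refine h.congr_fun fun n => ?_
  rw [inv_natCast_smul_eq ℚ_[ℓ] E, smul_eq_mul, div_eq_mul_inv, mul_comm]

/-- `exp (n a) = (exp a)ⁿ` for `n ∈ ℕ` on the closed ball (`ℓ ≠ 2`). [folklore] -/
theorem exp_natCast_mul_of_le (hℓ : ℓ ≠ 2) {a : E} (ha : ‖a‖ ≤ (ℓ : ℝ)⁻¹) (n : ℕ) :
    exp ((n : E) * a) = exp a ^ n := by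
  induction n with
  | zero => simp
  | succ n ih =>
    have hn : ‖(n : E) * a‖ ≤ (ℓ : ℝ)⁻¹ := by
      rw [norm_mul]
      exact (mul_le_of_le_one_left (norm_nonneg _) (PadicExp.norm_natCast_le_one (ℓ := ℓ) n)).trans ha
    rw [Nat.cast_succ, add_mul, one_mul, exp_add_of_le hℓ hn ha, ih, pow_succ]

end Complete

/-! ### Ultrametric estimates on the closed ball -/

section Ultra

variable [IsUltrametricDist E] [CompleteSpace E]

/-- **`‖exp a − 1 − a‖ ≤ ‖a‖²`** on the closed ball `‖a‖ ≤ ℓ⁻¹` (`ℓ ≠ 2`; every term `aⁿ/n!`,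
`n ≥ 2`, has norm `≤ ‖a‖²`). [folklore] -/
theorem norm_exp_sub_one_sub_self_le_sq (hℓ : ℓ ≠ 2) {a : E} (ha : ‖a‖ ≤ (ℓ : ℝ)⁻¹) :
    ‖exp a - 1 - a‖ ≤ ‖a‖ ^ 2 := by
  have hs := hasSum_exp_of_le hℓ ha
  have hs2 : HasSum (fun n : ℕ => a ^ (n + 2) / ((n + 2) ! : E)) (exp a - 1 - a) := by
    have h := (hasSum_nat_add_iff' 2).mpr hs
    simp only [Finset.sum_range_succ, Finset.sum_range_zero, zero_add, pow_zero,
      Nat.factorial_zero, Nat.cast_one, div_one, pow_one, Nat.factorial_one] at h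
    rw [show exp a - 1 - a = exp a - (1 + a) by ring]
    exact h
  rw [← hs2.tsum_eq]
  refine IsUltrametricDist.norm_tsum_le_of_forall_le_of_nonneg (by positivity) fun n => ?_
  have := norm_pow_div_factorial_le_sq hℓ ha (n := n + 2) (by omega)
  exact_mod_cast this

/-- `‖exp a − 1 − a‖ < ‖a‖` for `0 < ‖a‖ ≤ ℓ⁻¹` (`ℓ ≠ 2`). [folklore] -/
theorem norm_exp_sub_one_sub_self_lt (hℓ : ℓ ≠ 2) {a : E} (ha : ‖a‖ ≤ (ℓ : ℝ)⁻¹) (ha0 : a ≠ 0) :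
    ‖exp a - 1 - a‖ < ‖a‖ := by
  have hp : ℓ.Prime := Fact.out
  have ha1 : ‖a‖ < 1 := ha.trans_lt (inv_lt_one_of_one_lt₀ (by exact_mod_cast hp.one_lt))
  calc ‖exp a - 1 - a‖ ≤ ‖a‖ ^ 2 := norm_exp_sub_one_sub_self_le_sq hℓ ha
    _ = ‖a‖ * ‖a‖ := sq _
    _ < ‖a‖ * 1 := mul_lt_mul_of_pos_left ha1 (norm_pos_iff.mpr ha0)
    _ = ‖a‖ := mul_one _

/-- **`‖exp a − 1‖ = ‖a‖`** on the closed ball (`ℓ ≠ 2`). [folklore] -/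
theorem norm_exp_sub_one_of_le (hℓ : ℓ ≠ 2) {a : E} (ha : ‖a‖ ≤ (ℓ : ℝ)⁻¹) : ‖exp a - 1‖ = ‖a‖ := by
  by_cases ha0 : a = 0
  · subst ha0; simp
  have h := norm_exp_sub_one_sub_self_lt hℓ ha ha0
  have : exp a - 1 = (exp a - 1 - a) + a := by ring
  rw [this]
  exact IsUltrametricDist.norm_add_eq_max_of_norm_ne_norm h.ne ▸ max_eq_right h.le

/-- **`‖exp a‖ = 1`** on the closed ball (`ℓ ≠ 2`). [folklore] -/
theorem norm_exp_of_le (hℓ : ℓ ≠ 2) {a : E} (ha : ‖a‖ ≤ (ℓ : ℝ)⁻¹) : ‖exp a‖ = 1 := by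
  have hp : ℓ.Prime := Fact.out
  have h1 : ‖exp a - 1‖ < 1 := by
    rw [norm_exp_sub_one_of_le hℓ ha]
    exact ha.trans_lt (inv_lt_one_of_one_lt₀ (by exact_mod_cast hp.one_lt))
  have : exp a = (exp a - 1) + 1 := by ring
  rw [this]
  have hne : ‖exp a - 1‖ ≠ ‖(1 : E)‖ := by rw [norm_one]; exact h1.ne
  rw [IsUltrametricDist.norm_add_eq_max_of_norm_ne_norm hne, norm_one, max_eq_right h1.le]

/-- `exp a ≠ 0` on the closed ball (`ℓ ≠ 2`). [folklore] -/
theorem exp_ne_zero_of_le (hℓ : ℓ ≠ 2) {a : E} (ha : ‖a‖ ≤ (ℓ : ℝ)⁻¹) : exp a ≠ 0 := by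
  intro h
  have := norm_exp_of_le hℓ ha
  rw [h, norm_zero] at this
  exact zero_ne_one this

/-- `exp a = 1 ↔ a = 0` on the closed ball (`ℓ ≠ 2`). [folklore] -/
theorem exp_eq_one_iff_of_le (hℓ : ℓ ≠ 2) {a : E} (ha : ‖a‖ ≤ (ℓ : ℝ)⁻¹) : exp a = 1 ↔ a = 0 := by
  refine ⟨fun h => ?_, fun h => by rw [h, exp_zero]⟩
  have := norm_exp_sub_one_of_le hℓ ha
  rw [h, sub_self, norm_zero] at this
  exact norm_eq_zero.mp this.symm

omit [IsUltrametricDist E] in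
/-- `exp (−a) = (exp a)⁻¹` on the closed ball (`ℓ ≠ 2`). [folklore] -/
theorem exp_neg_of_le (hℓ : ℓ ≠ 2) {a : E} (ha : ‖a‖ ≤ (ℓ : ℝ)⁻¹) : exp (-a) = (exp a)⁻¹ := by
  have hna : ‖-a‖ ≤ (ℓ : ℝ)⁻¹ := by rwa [norm_neg]
  have hmem := mem_eball_of_norm_le hℓ ha
  have h1 : ‖exp a‖ ≠ 0 := by
    intro h0
    have h : exp a * exp (-a) = 1 := by rw [← exp_add_of_le hℓ ha hna, add_neg_cancel, exp_zero]
    rw [norm_eq_zero] at h0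
    rw [h0, zero_mul] at h
    exact zero_ne_one h
  have h : exp a * exp (-a) = 1 := by rw [← exp_add_of_le hℓ ha hna, add_neg_cancel, exp_zero]
  exact eq_inv_of_mul_eq_one_right h

/-- **`exp` is injective on the closed ball** `‖·‖ ≤ ℓ⁻¹` (`ℓ ≠ 2`). [folklore] -/
theorem exp_injOn_closedBall (hℓ : ℓ ≠ 2) : Set.InjOn (exp : E → E) {a : E | ‖a‖ ≤ (ℓ : ℝ)⁻¹} := by
  intro a ha b hb hab
  have ha' : ‖a‖ ≤ (ℓ : ℝ)⁻¹ := ha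
  have hb' : ‖b‖ ≤ (ℓ : ℝ)⁻¹ := hb
  have hnb : ‖-b‖ ≤ (ℓ : ℝ)⁻¹ := by rw [norm_neg]; exact hb'
  have hab' : ‖a + -b‖ ≤ (ℓ : ℝ)⁻¹ :=
    (IsUltrametricDist.norm_add_le_max a (-b)).trans (max_le ha' hnb)
  have h1 : exp (a + -b) = 1 := by
    rw [exp_add_of_le hℓ ha' hnb, exp_neg_of_le hℓ hb', hab, mul_inv_cancel₀ (exp_ne_zero_of_le hℓ hb')]
  have := (exp_eq_one_iff_of_le hℓ hab').mp h1
  rwa [← sub_eq_add_neg, sub_eq_zero] at this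

omit [IsUltrametricDist E] in
/-- `exp (z a) = (exp a)^z` for `z ∈ ℤ` on the closed ball (`ℓ ≠ 2`). [folklore] -/
theorem exp_intCast_mul_of_le (hℓ : ℓ ≠ 2) {a : E} (ha : ‖a‖ ≤ (ℓ : ℝ)⁻¹) (z : ℤ) :
    exp ((z : E) * a) = exp a ^ z := by
  obtain ⟨n, rfl | rfl⟩ := z.eq_nat_or_neg
  · rw [Int.cast_natCast, exp_natCast_mul_of_le hℓ ha, zpow_natCast]
  · have hn : ‖(n : E) * a‖ ≤ (ℓ : ℝ)⁻¹ := by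
      rw [norm_mul]
      exact (mul_le_of_le_one_left (norm_nonneg _) (PadicExp.norm_natCast_le_one (ℓ := ℓ) n)).trans ha
    rw [Int.cast_neg, Int.cast_natCast, neg_mul, exp_neg_of_le hℓ hn, exp_natCast_mul_of_le hℓ ha,
      zpow_neg, zpow_natCast]

end Ultra

end PadicExpOdd

end Summit.ABC.StewartYu

end
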